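import Summits.MatrixMultiplication.OmegaCensus.STPPVosperTilingTools

/-!
# ω-census (abelian STPP census): the exact-cover checker WITH the Def-5.1 words among the other blocks, and its soundness (kernel)

HONEST FRAMING (pub-omega census; verbatim): lottery ticket; floor = certified bounds/negative ranges.
Census STRUCTURE (seat pub-omega-stpp-1 gen 32, 2026-08-28), family (b2).  A strengthening of the exact-cover checker `existsCover`
(`STPPVosperTilingTools.lean`) used by the Vosper tiling law (`STPPVosperTilingLaw.lean`).  At a tight block `i` the difference sets
`Y_k = C_k − B_k`, `Z_k = C_k − A_k` of the OTHER blocks partition the two Vosper progressions `Y°`, `Z°`; `existsCover` searches for such partitions.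
The simultaneous triple product property (CKSU Def. 5.1: `x_l − y_j + z_k = 0` with `x_l ∈ X_l = A_l − B_l`, `y_j ∈ Y_j`, `z_k ∈ Z_k` only for
`l = j = k` and then only diagonally) says much more about these sets, and everything it says about the blocks `k ≠ i` and the two progressions is
decidable from the same normalised data:

* within one block `k`: `(a₁ − b) + (c − a₂) ∉ Y°` unless `a₁ = a₂`; `(c − b₁) − (a − b₂) ∉ Z°` unless `b₁ = b₂`; `(c₁ − b) − (c₂ − a) ∉ X_k` unless
  `c₁ = c₂` (`wordsIn`);
* across blocks (indices not all equal, NO exceptions): `(X_l + Z_k) ∩ Y° = ∅`, `(Y_j − X_l) ∩ Z° = ∅`, `(Y_j − Z_k) ∩ X_l = ∅` (`crossOK`; since only the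
  within-block tests carry exceptions, the merged lists of already placed `Y`/`Z`/`X` values suffice).

`existsCoverW p YL ZL cands uY uZ uX` runs the one-pass search of `existsCover` over PRECOMPUTED per-block candidate lists (`blockDiffsW`: value triples
`(C − B, C − A, A − B)` passing the duplicate-freeness and within-block word tests; the Z-points are a general list `ZL`) with these extra tests.
SOUNDNESS (`existsCoverW_complete`): if finsets of values realising the blocks with all the listed properties exist, the checker returns `true`; so a
kernel verdict `existsCoverW … = false` excludes them.  UNCONDITIONAL (no Hamidoune–Rødseth).  Nothing here is progress on `ω`.
Python mirror (exact semantics + step counter): HOME `pub-omega-stpp-1-g32/code/coverw_mirror.py`.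

References: H. Cohn, R. Kleinberg, B. Szegedy, C. Umans, FOCS 2005 (arXiv:math/0511460), Def. 5.1; A. G. Vosper, J. London Math. Soc. 31 (1956).
-/

open Finset
open scoped Pointwise

namespace Summit.MatrixMultiplication.OmegaCensus.CubeNB

open Literature.Computability.AlgebraicComplexity
open Literature.Combinatorics.Additive
open Summit.MatrixMultiplication.OmegaCensus.STPPKneser

/-! ## §1 The checker -/

section Checker

/-- Within-block Def-5.1 words for one block with value lists `C`, `B` (containing `0`), `A`, as residues modulo `p`:
`(a₁ − b) + (c − a₂) ∉ YL` unless `a₁ = a₂`; `(c − b₁) − (a − b₂) ∉ ZL` unless `b₁ = b₂`; `(c₁ − b) − (c₂ − a) ∉ A − B` unless `c₁ = c₂`.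
[cite: CohnKleinbergSzegedyUmans2005, Def. 5.1] -/
def wordsIn (p : ℕ) (YL ZL C B A : List ℕ) : Bool :=
  (A.all fun a₁ => A.all fun a₂ => decide (a₁ = a₂) || B.all fun b => C.all fun c =>
      !decide (((a₁ + p - b) % p + (c + p - a₂) % p) % p ∈ YL)) &&
  (B.all fun b₁ => B.all fun b₂ => decide (b₁ = b₂) || C.all fun c => A.all fun a =>
      !decide (((c + p - b₁) % p + p - (a + p - b₂) % p) % p ∈ ZL)) &&
  (C.all fun c₁ => C.all fun c₂ => decide (c₁ = c₂) || B.all fun b => A.all fun a =>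
      !decide (((c₁ + p - b) % p + p - (c₂ + p - a) % p) % p ∈ diffList p A B))

/-- The value triple `(C − B, C − A, A − B)` of one block candidate, if the three difference lists are duplicate-free and the within-block words hold.
[folklore] -/
def blockTriple (p : ℕ) (YL ZL C B A : List ℕ) : Option (List ℕ × List ℕ × List ℕ) :=
  if (diffList p C B).Nodup && (diffList p C A).Nodup && (diffList p A B).Nodup && wordsIn p YL ZL C B A then
    some (diffList p C B, diffList p C A, diffList p A B) else none

/-- Candidate value triples of ONE block of sizes `(a, b, c)`: `C` a `c`-sublist of the Y-points `YL`, `B = 0 :: B'` with `C − B ⊆ YL`, `A` with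
`C − A ⊆ ZL`, passing `blockTriple`. [folklore] -/
def blockDiffsW (p : ℕ) (YL ZL : List ℕ) (a b c : ℕ) : List (List ℕ × List ℕ × List ℕ) :=
  (YL.sublistsLen c).flatMap fun C =>
    (((candShift p C fun y => decide (y ∈ YL)).filter fun x => x != 0).sublistsLen (b - 1)).flatMap fun B' =>
      ((candShift p C fun t => decide (t ∈ ZL)).sublistsLen a).filterMap fun A => blockTriple p YL ZL C (0 :: B') A

/-- Cross-block Def-5.1 word tests of a new block with value triple `(Yn, Zn, Xn)` against the merged value lists `uY, uZ, uX` of the blocks placed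
before: `x + z ∉ YL`, `y − x ∉ ZL`, `y − z ∉ X` whenever the blocks involved are not all the same. [cite: CohnKleinbergSzegedyUmans2005, Def. 5.1] -/
def crossOK (p : ℕ) (YL ZL Yn Zn Xn uY uZ uX : List ℕ) : Bool :=
  (Xn.all fun x => uZ.all fun t => !decide ((x + t) % p ∈ YL)) &&
  (uX.all fun x => Zn.all fun t => !decide ((x + t) % p ∈ YL)) &&
  (Yn.all fun y => uX.all fun x => !decide ((y + p - x) % p ∈ ZL)) &&
  (uY.all fun y => Xn.all fun x => !decide ((y + p - x) % p ∈ ZL)) &&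
  (Yn.all fun y => Zn.all fun t => !decide ((y + p - t) % p ∈ uX)) &&
  (Yn.all fun y => uZ.all fun t => !decide ((y + p - t) % p ∈ Xn) && !decide ((y + p - t) % p ∈ uX)) &&
  (uY.all fun y => Zn.all fun t => !decide ((y + p - t) % p ∈ Xn) && !decide ((y + p - t) % p ∈ uX)) &&
  (uY.all fun y => uZ.all fun t => !decide ((y + p - t) % p ∈ Xn))

/-- **Exact-cover search with words.**  `existsCoverW p YL ZL cands uY uZ uX`: can one candidate triple be chosen from each list in `cands` (in order),
with Y-, Z- and X-values disjoint from the used lists `uY, uZ, uX` (and, recursively, from each other), passing the cross-block word tests, so that finally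
every point of `YL` is in `uY` and every point of `ZL` in `uZ`? [folklore] -/
def existsCoverW (p : ℕ) (YL ZL : List ℕ) : List (List (List ℕ × List ℕ × List ℕ)) → List ℕ → List ℕ → List ℕ → Bool
  | [], uY, uZ, _ => (YL.all fun y => decide (y ∈ uY)) && (ZL.all fun t => decide (t ∈ uZ))
  | cands :: rest, uY, uZ, uX =>
    cands.any fun T =>
      (T.1.all fun y => !decide (y ∈ uY)) && (T.2.1.all fun t => !decide (t ∈ uZ)) && (T.2.2.all fun x => !decide (x ∈ uX)) &&
      crossOK p YL ZL T.1 T.2.1 T.2.2 uY uZ uX &&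
      existsCoverW p YL ZL rest (T.1 ++ uY) (T.2.1 ++ uZ) (T.2.2 ++ uX)

end Checker

/-! ## §2 Soundness of the search over candidate lists -/

section SoundList

variable {ι : Type*}

/-- **Soundness of the search (list level).**  Blocks `k` (`good k`) with value lists `Al k, Bl k, Cl k`; write `DY k = Cl k − Bl k`, `DZ k = Cl k − Al k`,
`DX k = Al k − Bl k` (as `diffList`s).  If the triple `(DY k, DZ k, DX k)` is in the candidate list `cand k`, the `DY` (`DZ`, `DX`) of distinct good blocks
are disjoint, the cross-block words hold (`x + z ∉ YL`, `y − x ∉ ZL`, `y − z ∉ DX l` unless all blocks coincide) and the `DY` (`DZ`) of the good blocks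
cover `YL` (`ZL`), then for every duplicate-free list `ks` of good blocks and used lists made of values of good blocks outside `ks` and containing all of them,
`existsCoverW p YL ZL (ks.map cand) uY uZ uX = true`. [folklore] -/
theorem existsCoverW_complete_list {p : ℕ} {YL ZL : List ℕ} (good : ι → Prop) (Al Bl Cl : ι → List ℕ)
    (cand : ι → List (List ℕ × List ℕ × List ℕ))
    (hcand : ∀ k, good k → (diffList p (Cl k) (Bl k), diffList p (Cl k) (Al k), diffList p (Al k) (Bl k)) ∈ cand k)
    (hdY : ∀ k k', good k → good k' → k ≠ k' → ∀ y ∈ diffList p (Cl k) (Bl k), y ∉ diffList p (Cl k') (Bl k'))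
    (hdZ : ∀ k k', good k → good k' → k ≠ k' → ∀ t ∈ diffList p (Cl k) (Al k), t ∉ diffList p (Cl k') (Al k'))
    (hdX : ∀ k k', good k → good k' → k ≠ k' → ∀ x ∈ diffList p (Al k) (Bl k), x ∉ diffList p (Al k') (Bl k'))
    (hXZ : ∀ l k, good l → good k → l ≠ k → ∀ x ∈ diffList p (Al l) (Bl l), ∀ t ∈ diffList p (Cl k) (Al k), (x + t) % p ∉ YL)
    (hYX : ∀ j l, good j → good l → j ≠ l → ∀ y ∈ diffList p (Cl j) (Bl j), ∀ x ∈ diffList p (Al l) (Bl l), (y + p - x) % p ∉ ZL)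
    (hYZ : ∀ j k l, good j → good k → good l → ¬(j = k ∧ k = l) →
      ∀ y ∈ diffList p (Cl j) (Bl j), ∀ t ∈ diffList p (Cl k) (Al k), (y + p - t) % p ∉ diffList p (Al l) (Bl l))
    (hcY : ∀ y ∈ YL, ∃ k, good k ∧ y ∈ diffList p (Cl k) (Bl k)) (hcZ : ∀ t ∈ ZL, ∃ k, good k ∧ t ∈ diffList p (Cl k) (Al k)) :
    ∀ (ks : List ι), ks.Nodup → (∀ k ∈ ks, good k) → ∀ (uY uZ uX : List ℕ),
      (∀ y ∈ uY, ∃ k, good k ∧ k ∉ ks ∧ y ∈ diffList p (Cl k) (Bl k)) →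
      (∀ t ∈ uZ, ∃ k, good k ∧ k ∉ ks ∧ t ∈ diffList p (Cl k) (Al k)) →
      (∀ x ∈ uX, ∃ k, good k ∧ k ∉ ks ∧ x ∈ diffList p (Al k) (Bl k)) →
      (∀ k, good k → k ∉ ks → ∀ y ∈ diffList p (Cl k) (Bl k), y ∈ uY) →
      (∀ k, good k → k ∉ ks → ∀ t ∈ diffList p (Cl k) (Al k), t ∈ uZ) →
      existsCoverW p YL ZL (ks.map cand) uY uZ uX = true := by
  intro ks
  induction ks with
  | nil =>
    intro _ _ uY uZ uX _ _ _ hqY hqZ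
    rw [List.map_nil, existsCoverW, Bool.and_eq_true, List.all_eq_true, List.all_eq_true]
    refine ⟨fun y hy => ?_, fun t ht => ?_⟩
    · rw [decide_eq_true_eq]
      obtain ⟨k, hk, hyk⟩ := hcY y hy
      exact hqY k hk (List.not_mem_nil) y hyk
    · rw [decide_eq_true_eq]
      obtain ⟨k, hk, htk⟩ := hcZ t ht
      exact hqZ k hk (List.not_mem_nil) t htk
  | cons k rest ih =>
    intro hnd hgood uY uZ uX hpY hpZ hpX hqY hqZ
    rw [List.nodup_cons] at hnd
    obtain ⟨hkrest, hndrest⟩ := hnd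
    have hgk : good k := hgood k (by simp)
    have hgrest : ∀ k' ∈ rest, good k' := fun k' hk' => hgood k' (by simp [hk'])
    rw [List.map_cons, existsCoverW, List.any_eq_true]
    refine ⟨_, hcand k hgk, ?_⟩
    simp only [Bool.and_eq_true, List.all_eq_true, Bool.not_eq_true', decide_eq_false_iff_not]
    refine ⟨⟨⟨⟨fun y hy hyu => ?_, fun t ht htu => ?_⟩, fun x hx hxu => ?_⟩, ?_⟩, ?_⟩
    · obtain ⟨k₀, hg₀, hk₀, hy₀⟩ := hpY y hyu
      exact hdY k k₀ hgk hg₀ (fun h => hk₀ (h ▸ by simp)) y hy hy₀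
    · obtain ⟨k₀, hg₀, hk₀, ht₀⟩ := hpZ t htu
      exact hdZ k k₀ hgk hg₀ (fun h => hk₀ (h ▸ by simp)) t ht ht₀
    · obtain ⟨k₀, hg₀, hk₀, hx₀⟩ := hpX x hxu
      exact hdX k k₀ hgk hg₀ (fun h => hk₀ (h ▸ by simp)) x hx hx₀
    · -- the cross-block words
      rw [crossOK]
      simp only [Bool.and_eq_true, List.all_eq_true, Bool.not_eq_true', decide_eq_false_iff_not]
      refine ⟨⟨⟨⟨⟨⟨⟨fun x hx t ht => ?_, fun x hx t ht => ?_⟩, fun y hy x hx => ?_⟩, fun y hy x hx => ?_⟩, fun y hy t ht => ?_⟩,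
        fun y hy t ht => ⟨?_, ?_⟩⟩, fun y hy t ht => ⟨?_, ?_⟩⟩, fun y hy t ht => ?_⟩
      · obtain ⟨k₀, hg₀, hk₀, ht₀⟩ := hpZ t ht
        exact hXZ k k₀ hgk hg₀ (fun h => hk₀ (h ▸ by simp)) x hx t ht₀
      · obtain ⟨k₀, hg₀, hk₀, hx₀⟩ := hpX x hx
        exact hXZ k₀ k hg₀ hgk (fun h => hk₀ (h ▸ by simp)) x hx₀ t ht
      · obtain ⟨k₀, hg₀, hk₀, hx₀⟩ := hpX x hx
        exact hYX k k₀ hgk hg₀ (fun h => hk₀ (h ▸ by simp)) y hy x hx₀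
      · obtain ⟨k₀, hg₀, hk₀, hy₀⟩ := hpY y hy
        exact hYX k₀ k hg₀ hgk (fun h => hk₀ (h ▸ by simp)) y hy₀ x hx
      · intro hmem
        obtain ⟨k₀, hg₀, hk₀, hx₀⟩ := hpX _ hmem
        exact hYZ k k k₀ hgk hgk hg₀ (fun h => hk₀ (h.2 ▸ by simp)) y hy t ht hx₀
      · obtain ⟨k₀, hg₀, hk₀, ht₀⟩ := hpZ t ht
        exact hYZ k k₀ k hgk hg₀ hgk (fun h => hk₀ (h.1 ▸ by simp)) y hy t ht₀
      · intro hmem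
        obtain ⟨k₀, hg₀, hk₀, ht₀⟩ := hpZ t ht
        obtain ⟨k₁, hg₁, -, hx₁⟩ := hpX _ hmem
        exact hYZ k k₀ k₁ hgk hg₀ hg₁ (fun h => hk₀ (h.1 ▸ by simp)) y hy t ht₀ hx₁
      · obtain ⟨k₀, hg₀, hk₀, hy₀⟩ := hpY y hy
        exact hYZ k₀ k k hg₀ hgk hgk (fun h => hk₀ (h.1 ▸ by simp)) y hy₀ t ht
      · intro hmem
        obtain ⟨k₀, hg₀, hk₀, hy₀⟩ := hpY y hy
        obtain ⟨k₁, hg₁, -, hx₁⟩ := hpX _ hmem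
        exact hYZ k₀ k k₁ hg₀ hgk hg₁ (fun h => hk₀ (h.1 ▸ by simp)) y hy₀ t ht hx₁
      · obtain ⟨k₀, hg₀, -, hy₀⟩ := hpY y hy
        obtain ⟨k₁, hg₁, hk₁, ht₁⟩ := hpZ t ht
        exact hYZ k₀ k₁ k hg₀ hg₁ hgk (fun h => hk₁ (h.2 ▸ by simp)) y hy₀ t ht₁
    · -- the recursive call
      apply ih hndrest hgrest
      · intro y hy
        rw [List.mem_append] at hy
        rcases hy with h | h
        · exact ⟨k, hgk, hkrest, h⟩
        · obtain ⟨k₀, hg₀, hk₀, hy₀⟩ := hpY y h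
          exact ⟨k₀, hg₀, fun hm => hk₀ (by simp [hm]), hy₀⟩
      · intro t ht
        rw [List.mem_append] at ht
        rcases ht with h | h
        · exact ⟨k, hgk, hkrest, h⟩
        · obtain ⟨k₀, hg₀, hk₀, ht₀⟩ := hpZ t h
          exact ⟨k₀, hg₀, fun hm => hk₀ (by simp [hm]), ht₀⟩
      · intro x hx
        rw [List.mem_append] at hx
        rcases hx with h | h
        · exact ⟨k, hgk, hkrest, h⟩
        · obtain ⟨k₀, hg₀, hk₀, hx₀⟩ := hpX x h
          exact ⟨k₀, hg₀, fun hm => hk₀ (by simp [hm]), hx₀⟩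
      · intro k' hg' hk' y hy
        rw [List.mem_append]
        by_cases hkk : k' = k
        · subst hkk; exact Or.inl hy
        · exact Or.inr (hqY k' hg' (by simp [hkk, hk']) y hy)
      · intro k' hg' hk' t ht
        rw [List.mem_append]
        by_cases hkk : k' = k
        · subst hkk; exact Or.inl ht
        · exact Or.inr (hqZ k' hg' (by simp [hkk, hk']) t ht)

end SoundList

end Summit.MatrixMultiplication.OmegaCensus.CubeNB
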